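import Summits.Ventures.HodgeRepro.CyclicRecipeMain

/-!
# The cyclic recipe: a single-class `SumTwo` quadruple without a conjugate pair on EVERY cyclic `(ℤ/2m, m)` with
`m = r·p·q`, `r ≥ 2`, `p ≠ q` odd primes

Blind re-derivation cell `pub-hodge-repro`, seat `p1` (gen 9).  `CyclicPrimePowerNoSingleClass.lean` (one odd prime) and
`CyclicTwoPrimesNoSingleClass.lean` (`m = pq`) are the two «no» directions of the cyclic classification; this file is the
general «yes» direction, on the kernel: for every `m = r p q` with `r ≥ 2` and `p ≠ q` odd primes, the cyclic group
`ℤ/2m` with involution `m` carries a PRIMITIVE CM type `Φ` and twists `0, rq, rp, rq + rp` whose four translates form a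
`SumTwo` quadruple with no complex-conjugate pair.  Together: a cyclic `(ℤ/2m, m)` carries a single-class `SumTwo`
quadruple of CM types without a conjugate pair **iff** `m` has at least two odd prime factors and `m ≠ pq`.

## The recipe (P1.md §14, addenda 1–3)

Write `N = 2m = 2rpq`, `P₁ = N/p = 2rq`, `P₂ = N/q = 2rp`.  The residue classes of `ℤ/N` modulo `r` are permuted by
`x ↦ x + m` within themselves (`m ≡ r (mod 2r)`, `pq` odd) and so is each class by `x ↦ x + rq` and `x ↦ x + rp`.  The type
`Φ` is the half-interval rule `x mod P₂ < rp` on the class `1 (mod r)` and the half-interval rule `x mod P₁ < rq` on every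
other class (`InPhi`).  Then
* `Φ` is a CM type for `c = m` (`isCMType_Φ`): on the class `1` the shift by `m = q · rp` (`q` odd) is the shift by `rp`, which
  flips the half-interval mod `P₂`; elsewhere `m = p · rq` flips the half-interval mod `P₁`;
* `SumTwo` for `T i = Φ · g i`, `g = (0, rq, rp, rq + rp)` (`sumTwo_T`): at an `x` outside the class `1` the corners pair off
  as `{x, x − rq}` and `{x − rp, x − rp − rq}` (one of each pair in `Φ`), on the class `1` as `{x, x − rp}`, `{x − rq, x − rq − rp}`;
* no two corners are complex-conjugate (`T_noConjugatePair`): `Φ · g j = c • Φ · g i` would make `Φ` antiperiodic under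
  `d = g j − g i`, refuted by an explicit pair `w, w + d ∈ Φ` — two points of a half-interval at distance `δ` exist unless
  `δ ≡ n (mod 2n)` (`exists_half_pair`), and `q ≢ p (mod 2p)`, `p ≢ q (mod 2q)`, `p + q ≢ p (mod 2p)`;
* `Φ` is primitive (`isPrimitive_Φ`): a period `h` must preserve the classes mod `r` (else the class `1 − h` would satisfy
  both flips, impossible by `exists_half_pair`), and then it must be a period of both half-interval rules, i.e. `2p ∣ h/r`
  and `2q ∣ h/r`, so `N ∣ h`;
* the Pohlmann `4`-set `Δ = {1, (g 1)⁻¹, (g 2)⁻¹, (g 3)⁻¹}` is exceptional (`Δ_isExceptional`, from the typer's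
  `isHodgeSet_twistSet` and `c • Δ ≠ Δ`) and a coset of no subgroup (`Δ_not_coset`).

SPLIT (p1 gen 10, for the cell's ≤ 400-line landing rule; declaration text unchanged): part 1 `CyclicRecipeArith.lean` (the
`ℕ` arithmetic and the membership rule), part 2 `CyclicRecipeMain.lean` (the type, the twists, the quadruple and the first
existence theorem), and this part 3 — the Pohlmann `4`-set, the `m`-form and the numeric instances — which keeps the
module name, so every importer's header is untouched.
-/


set_option autoImplicit false

open Finset
open scoped Pointwise

namespace HodgeRepro.CyclicRecipe

variable {N : ℕ} [NeZero N]

section main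

variable {r p q : ℕ} (hN : N = 2 * (r * p * q))
include hN

/-! ### The Pohlmann `4`-set `Δ = {1, (g 1)⁻¹, (g 2)⁻¹, (g 3)⁻¹}` -/

omit [NeZero N] hN in
/-- `0 < a < N ⇒ (a : ℤ/N) ≠ 0`. -/
theorem natCast_ne_zero_of_lt {a : ℕ} (ha : 0 < a) (haN : a < N) : (a : ZMod N) ≠ 0 := by
  intro h
  rw [ZMod.natCast_eq_zero_iff] at h
  exact absurd (Nat.le_of_dvd ha h) (not_le.mpr haN)

omit hN in
/-- Each twist is `< N`, and `rq + rp + m < N` (`p + q < pq` for `p, q ≥ 3`). -/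
theorem gn_bounds (hr : 2 ≤ r) (hp : p.Prime) (hq : q.Prime) (hp2 : p ≠ 2) (hq2 : q ≠ 2) :
    r * q + r * p + r * p * q < 2 * (r * p * q) := by
  have hp3 : 3 ≤ p := by have := hp.two_le; omega
  have hq3 : 3 ≤ q := by have := hq.two_le; omega
  have h1 : p + q < p * q := by nlinarith
  have h2 : r * (p + q) < r * (p * q) := Nat.mul_lt_mul_of_pos_left h1 (by omega)
  rw [Nat.mul_add, ← Nat.mul_assoc] at h2
  omega

omit [NeZero N] in
/-- `m = rpq` is a complex conjugation of `ℤ/N` in the typer's sense. -/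
theorem isComplexConj_cc (hr : 2 ≤ r) (hp : p.Prime) (hq : q.Prime) : IsComplexConj (cc N r p q) where
  ne_one := by
    intro h
    rw [cc, ← ofAdd_zero] at h
    have h0 := Multiplicative.ofAdd.injective h
    refine natCast_ne_zero_of_lt (N := N) (Nat.pos_of_ne_zero ?_) ?_ h0
    · have := Nat.mul_pos (Nat.mul_pos (by omega : 0 < r) hp.pos) hq.pos; omega
    · rw [hN]; have := Nat.mul_pos (Nat.mul_pos (by omega : 0 < r) hp.pos) hq.pos; omega
  mul_self := by
    rw [cc, ← ofAdd_add, ← Nat.cast_add, ← two_mul, ← hN, ZMod.natCast_self, ofAdd_zero]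
  comm := fun g => mul_comm _ g

omit [NeZero N] in
/-- The twists are pairwise distinct. -/
theorem gg_injective (hr : 2 ≤ r) (hp : p.Prime) (hq : q.Prime) (hpq : p ≠ q) : Function.Injective (gg N r p q) := by
  have hr0 : 0 < r := by omega
  have hrq0 : 0 < r * q := Nat.mul_pos hr0 hq.pos
  have hrp0 : 0 < r * p := Nat.mul_pos hr0 hp.pos
  have hne : r * q ≠ r * p := fun h => hpq.symm (Nat.eq_of_mul_eq_mul_left hr0 h)
  have hlt : r * q + r * p < N := by
    rw [hN]; have := Nat.mul_pos hrp0 hq.pos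
    nlinarith [Nat.mul_le_mul_left (r * p) hq.two_le, Nat.mul_le_mul_left (r * q) hp.two_le,
      show r * p * q = r * q * p by ring]
  intro i j hij
  rw [gg, gg] at hij
  have h1 := Multiplicative.ofAdd.injective hij
  rw [ZMod.natCast_eq_natCast_iff'] at h1
  have hi : gn r p q i < N := by
    fin_cases i <;> simp only [gn, Fin.reduceFinMk, Matrix.cons_val] <;> omega
  have hj : gn r p q j < N := by
    fin_cases j <;> simp only [gn, Fin.reduceFinMk, Matrix.cons_val] <;> omega
  rw [Nat.mod_eq_of_lt hi, Nat.mod_eq_of_lt hj] at h1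
  fin_cases i <;> fin_cases j <;> simp only [gn, Fin.reduceFinMk, Matrix.cons_val] at h1 ⊢ <;> omega

/-- The Pohlmann `4`-set of the quadruple: `Δ = {1, (g 1)⁻¹, (g 2)⁻¹, (g 3)⁻¹}` (the typer's `twistSet g 1`). -/
def Δ (N r p q : ℕ) : Finset (Multiplicative (ZMod N)) := twistSet (gg N r p q) 1

omit [NeZero N] hN in
/-- `(g i)⁻¹ ∈ Δ`. -/
theorem inv_gg_mem_Δ (i : Fin 4) : (gg N r p q i)⁻¹ ∈ Δ N r p q := by
  rw [Δ, twistSet, mem_image]; exact ⟨i, mem_univ _, one_mul _⟩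

omit [NeZero N] hN in
/-- `1 ∈ Δ`. -/
theorem one_mem_Δ : (1 : Multiplicative (ZMod N)) ∈ Δ N r p q := by
  have := inv_gg_mem_Δ (N := N) (r := r) (p := p) (q := q) 0
  rwa [gg, show gn r p q 0 = 0 from rfl, Nat.cast_zero, ofAdd_zero, inv_one] at this

omit [NeZero N] in
/-- `Δ` is not conjugation-stable: `c = c · 1 ∈ c • Δ` but `c ∉ Δ` (every `(g i)⁻¹ · c⁻¹` is a nonzero residue `< N`). -/
theorem smul_Δ_ne (hr : 2 ≤ r) (hp : p.Prime) (hq : q.Prime) (hp2 : p ≠ 2) (hq2 : q ≠ 2) :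
    cc N r p q • Δ N r p q ≠ Δ N r p q := by
  intro h
  have hc : cc N r p q ∈ Δ N r p q := by
    rw [← h]; simpa using Finset.smul_mem_smul_finset (a := cc N r p q) (one_mem_Δ (N := N) (r := r) (p := p) (q := q))
  rw [Δ, twistSet, mem_image] at hc
  obtain ⟨i, -, hi⟩ := hc
  rw [one_mul] at hi
  have hmul : gg N r p q i * cc N r p q = 1 := by rw [← hi, mul_inv_cancel]
  rw [gg, cc, ← ofAdd_add, ← Nat.cast_add, ← ofAdd_zero] at hmul
  have h0 := Multiplicative.ofAdd.injective hmul
  have hb := gn_bounds (r := r) hr hp hq hp2 hq2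
  have hpos : 0 < r * p * q := Nat.mul_pos (Nat.mul_pos (by omega) hp.pos) hq.pos
  refine natCast_ne_zero_of_lt (N := N) ?_ ?_ h0
  · omega
  · rw [hN]; fin_cases i <;> simp only [gn, Fin.reduceFinMk, Matrix.cons_val] <;> omega

/-- **`⟨Δ⟩` is an exceptional Hodge class candidate on `A_Φ`** (Pohlmann's condition by the typer's `isHodgeSet_twistSet`,
not conjugation-stable). -/
theorem Δ_isExceptional (hr : 2 ≤ r) (hp : p.Prime) (hq : q.Prime) (hp2 : p ≠ 2) (hq2 : q ≠ 2) (hpq : p ≠ q) :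
    IsExceptional (cc N r p q) (Φ N r p q) (Δ N r p q) :=
  ⟨isHodgeSet_twistSet (isComplexConj_cc hN hr hp hq) (Φ N r p q) (gg N r p q) (gg_injective hN hr hp hq hpq)
      (sumTwo_T hN hr hp.pos hq.pos) 1,
    smul_Δ_ne hN hr hp hq hp2 hq2⟩

omit [NeZero N] in
/-- **`Δ` is a coset of NO subgroup**: the class is Weil relative to no subfield.  A coset `H h` containing `1` is `H`
itself, so `H` would contain `(g 1)⁻¹` and hence `g 1 = rq`, which is `(g i)⁻¹` for no `i` (`rq + g i` is a nonzero
residue `< N`). -/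
theorem Δ_not_coset (hr : 2 ≤ r) (hp : p.Prime) (hq : q.Prime) (hp2 : p ≠ 2) (hq2 : q ≠ 2) :
    ¬ ∃ (H : Subgroup (Multiplicative (ZMod N))) (h : Multiplicative (ZMod N)),
      ∀ x, x ∈ Δ N r p q ↔ ∃ k ∈ H, x = k * h := by
  rintro ⟨H, h, hH⟩
  obtain ⟨k₀, hk₀, hk₀'⟩ := (hH 1).mp one_mem_Δ
  have hh : h ∈ H := by
    rw [eq_inv_of_mul_eq_one_right hk₀'.symm]; exact H.inv_mem hk₀
  have hΔH : ∀ x, x ∈ Δ N r p q ↔ x ∈ H := by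
    intro x
    rw [hH x]
    constructor
    · rintro ⟨k, hk, rfl⟩; exact H.mul_mem hk hh
    · intro hx; exact ⟨x * h⁻¹, H.mul_mem hx (H.inv_mem hh), by simp⟩
  have ha : (gg N r p q 1)⁻¹ ∈ H := (hΔH _).mp (inv_gg_mem_Δ 1)
  have hb : gg N r p q 1 ∈ Δ N r p q := (hΔH _).mpr (by simpa using H.inv_mem ha)
  rw [Δ, twistSet, mem_image] at hb
  obtain ⟨i, -, hi⟩ := hb
  rw [one_mul] at hi
  have hmul : gg N r p q 1 * gg N r p q i = 1 := by rw [← hi, inv_mul_cancel]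
  rw [gg, gg, ← ofAdd_add, ← Nat.cast_add, ← ofAdd_zero] at hmul
  have h0 := Multiplicative.ofAdd.injective hmul
  have hb := gn_bounds (r := r) hr hp hq hp2 hq2
  have hrq0 : 0 < r * q := Nat.mul_pos (by omega) hq.pos
  have hrp0 : 0 < r * p := Nat.mul_pos (by omega) hp.pos
  have hrpq : r * p * q = r * q * p := by ring
  have h3 : r * q * 3 ≤ r * q * p := Nat.mul_le_mul_left _ (by have := hp.two_le; omega)
  refine natCast_ne_zero_of_lt (N := N) ?_ ?_ h0
  · show 0 < r * q + gn r p q i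
    omega
  · show r * q + gn r p q i < N
    rw [hN]; fin_cases i <;> simp only [gn, Fin.reduceFinMk, Matrix.cons_val] <;> omega

/-- **The cyclic recipe, full form**: the quadruple's base type is a PRIMITIVE CM type, its Pohlmann `4`-set is exceptional
and a coset of no subgroup. -/
theorem exists_singleClass_sumTwo_primitive_cyclic_full (hr : 2 ≤ r) (hp : p.Prime) (hq : q.Prime) (hp2 : p ≠ 2)
    (hq2 : q ≠ 2) (hpq : p ≠ q) :
    ∃ (Φ : Finset (Multiplicative (ZMod N))) (g : Fin 4 → Multiplicative (ZMod N)),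
      IsCMType (Multiplicative.ofAdd ((r * p * q : ℕ) : ZMod N)) Φ ∧ IsPrimitive Φ ∧
      SumTwo (fun i => rmul Φ (g i)) ∧
      (∀ i j : Fin 4, rmul Φ (g j) ≠ Multiplicative.ofAdd ((r * p * q : ℕ) : ZMod N) • rmul Φ (g i)) ∧
      IsExceptional (Multiplicative.ofAdd ((r * p * q : ℕ) : ZMod N)) Φ (twistSet g 1) ∧
      ¬ ∃ (H : Subgroup (Multiplicative (ZMod N))) (h : Multiplicative (ZMod N)),
        ∀ x, x ∈ twistSet g 1 ↔ ∃ k ∈ H, x = k * h :=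
  ⟨Φ N r p q, gg N r p q, isCMType_Φ hN (by omega) (hp.odd_of_ne_two hp2) (hq.odd_of_ne_two hq2),
    isPrimitive_Φ hN hr hp hq hq2 hpq, sumTwo_T hN hr hp.pos hq.pos, T_noConjugatePair hN hr hp hq hp2 hq2 hpq,
    Δ_isExceptional hN hr hp hq hp2 hq2 hpq, Δ_not_coset hN hr hp hq hp2 hq2⟩

end main

/-! ### The `m`-form and numeric instances -/

/-- **The cyclic recipe in terms of `m`**: on `(ℤ/2m, m)` with two distinct odd prime divisors `p ≠ q` of `m` and `m ≠ pq`,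
a PRIMITIVE CM type carries a single-class `SumTwo` quadruple without a conjugate pair. -/
theorem exists_singleClass_sumTwo_primitive_cyclic_of_dvd {m p q : ℕ} (hN : N = 2 * m) (hp : p.Prime) (hq : q.Prime)
    (hp2 : p ≠ 2) (hq2 : q ≠ 2) (hpq : p ≠ q) (hpm : p ∣ m) (hqm : q ∣ m) (hne : m ≠ p * q) :
    ∃ T : Fin 4 → Finset (Multiplicative (ZMod N)),
      IsCMType (Multiplicative.ofAdd ((m : ℕ) : ZMod N)) (T 0) ∧ IsPrimitive (T 0) ∧ SumTwo T ∧
      (∀ i j : Fin 4, T j ≠ Multiplicative.ofAdd ((m : ℕ) : ZMod N) • T i) ∧ IsSingleClass T := by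
  have hcop : Nat.Coprime p q := (Nat.coprime_primes hp hq).mpr hpq
  obtain ⟨r, hr⟩ := hcop.mul_dvd_of_dvd_of_dvd hpm hqm
  have hm0 : m ≠ 0 := by
    intro h; rw [h, Nat.mul_zero] at hN; exact (NeZero.ne N) hN
  have hr2 : 2 ≤ r := by
    rcases r with _ | _ | r
    · rw [Nat.mul_zero] at hr; exact absurd hr hm0
    · rw [Nat.mul_one] at hr; exact absurd hr hne
    · omega
  have hN' : N = 2 * (r * p * q) := by rw [hN, hr]; ring
  have e : ((m : ℕ) : ZMod N) = ((r * p * q : ℕ) : ZMod N) := by rw [hr]; congr 1; ring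
  rw [e]
  exact exists_singleClass_sumTwo_primitive_cyclic hN' hr2 hp hq hp2 hq2 hpq

/-- Degree `60` (`r = 2`, `p = 3`, `q = 5`): the kernel witness of `SingleClass60Witness` is an instance of the recipe. -/
theorem instance_C60 :
    ∃ T : Fin 4 → Finset (Multiplicative (ZMod 60)),
      IsCMType (Multiplicative.ofAdd (30 : ZMod 60)) (T 0) ∧ IsPrimitive (T 0) ∧ SumTwo T ∧
      (∀ i j : Fin 4, T j ≠ Multiplicative.ofAdd (30 : ZMod 60) • T i) ∧ IsSingleClass T :=
  exists_singleClass_sumTwo_primitive_cyclic (N := 60) (r := 2) (p := 3) (q := 5) rfl (by norm_num) (by norm_num)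
    (by norm_num) (by norm_num) (by norm_num) (by norm_num)

/-- Degree `84` (`r = 2`, `p = 3`, `q = 7`): the kernel witness of `SingleClass84Witness` is an instance of the recipe. -/
theorem instance_C84 :
    ∃ T : Fin 4 → Finset (Multiplicative (ZMod 84)),
      IsCMType (Multiplicative.ofAdd (42 : ZMod 84)) (T 0) ∧ IsPrimitive (T 0) ∧ SumTwo T ∧
      (∀ i j : Fin 4, T j ≠ Multiplicative.ofAdd (42 : ZMod 84) • T i) ∧ IsSingleClass T :=
  exists_singleClass_sumTwo_primitive_cyclic (N := 84) (r := 2) (p := 3) (q := 7) rfl (by norm_num) (by norm_num)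
    (by norm_num) (by norm_num) (by norm_num) (by norm_num)

/-- Degree `90` (`r = 3`, `p = 3`, `q = 5`; `m = 45 = 3² · 5`). -/
theorem instance_C90 :
    ∃ T : Fin 4 → Finset (Multiplicative (ZMod 90)),
      IsCMType (Multiplicative.ofAdd (45 : ZMod 90)) (T 0) ∧ IsPrimitive (T 0) ∧ SumTwo T ∧
      (∀ i j : Fin 4, T j ≠ Multiplicative.ofAdd (45 : ZMod 90) • T i) ∧ IsSingleClass T :=
  exists_singleClass_sumTwo_primitive_cyclic (N := 90) (r := 3) (p := 3) (q := 5) rfl (by norm_num) (by norm_num)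
    (by norm_num) (by norm_num) (by norm_num) (by norm_num)

/-- Degree `120` (`r = 4`, `p = 3`, `q = 5`). -/
theorem instance_C120 :
    ∃ T : Fin 4 → Finset (Multiplicative (ZMod 120)),
      IsCMType (Multiplicative.ofAdd (60 : ZMod 120)) (T 0) ∧ IsPrimitive (T 0) ∧ SumTwo T ∧
      (∀ i j : Fin 4, T j ≠ Multiplicative.ofAdd (60 : ZMod 120) • T i) ∧ IsSingleClass T :=
  exists_singleClass_sumTwo_primitive_cyclic (N := 120) (r := 4) (p := 3) (q := 5) rfl (by norm_num) (by norm_num)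
    (by norm_num) (by norm_num) (by norm_num) (by norm_num)

/-- Degree `210` (`r = 7`, `p = 3`, `q = 5`; three odd primes, `m = 105`). -/
theorem instance_C210 :
    ∃ T : Fin 4 → Finset (Multiplicative (ZMod 210)),
      IsCMType (Multiplicative.ofAdd (105 : ZMod 210)) (T 0) ∧ IsPrimitive (T 0) ∧ SumTwo T ∧
      (∀ i j : Fin 4, T j ≠ Multiplicative.ofAdd (105 : ZMod 210) • T i) ∧ IsSingleClass T :=
  exists_singleClass_sumTwo_primitive_cyclic (N := 210) (r := 7) (p := 3) (q := 5) rfl (by norm_num) (by norm_num)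
    (by norm_num) (by norm_num) (by norm_num) (by norm_num)

end HodgeRepro.CyclicRecipe
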